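import Mathlib
import Literature.AlgebraicGeometry.HodgeTheory.WeilClassesCyclicPrym
import Literature.AlgebraicGeometry.HodgeTheory.WeilClassesCyclicPrymDegreeFour
import Literature.AlgebraicGeometry.HodgeTheory.WeilClassesCyclicPrymTyping
import Literature.AlgebraicGeometry.HodgeTheory.WeilClassesSixfoldsSqrtMinus1Koike
import Literature.AlgebraicGeometry.HodgeTheory.WeilClassesFourfoldsDiscOneSchoen
import Literature.AlgebraicGeometry.HodgeTheory.WeilTypeAbelianVariety
import HarnessLib

/-!
# Weil classes on Schoen's primitive Pryms of cyclic ÉTALE covers of degree `3`, `4`, `6` — ALL GENERA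

Family `hodge`, layer `Literature/AlgebraicGeometry/HodgeTheory`. One file for ONE source section:
C. Schoen, *Hodge classes on self-products of a variety with an automorphism*, Compositio Math. 65 (1988)
3–32 [`Schoen1988HodgeWeil`, REFEREED], §2 Thm. 2.0 with §3 Cor. 3.1 in the UNRAMIFIED case `r = 0`, as
re-proved and re-stated by D. Patel, Y. Zhang, *Algebraicity of Hodge classes on some generalized Prym
varieties*, J. Algebra 712 (2027) 101–122 = arXiv:2506.13729 [`PatelZhang2025PrymHodge`, REFEREED], Thm. 1.2,
§5 Lemma 5.1, §5.1 and Thm. 5.3 — restricted to the three degrees `m ∈ {3, 4, 6}` for which the cyclotomic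
field `ℚ(μ_m)` is imaginary QUADRATIC (`φ(m) = 2`: `ℚ(μ₃) = ℚ(μ₆) = ℚ(√-3)`, `ℚ(μ₄) = ℚ(i)`), i.e. for which
Schoen's primitive Prym is an abelian variety of Weil type in the classical sense (`U'` = Weil's plane of Weil classes).

The tree already holds these theorems at FIXED genera, each with a `-- TODO(general form)` line:
`Schoen1988_cyclicPrym_weilClasses_algebraic_degreeThree` (`g(C') = 5`, eightfold), `…_degreeThree_genusFour`
(`g(C') = 4`, sixfold), `…_degreeSix` (`g(C'') = 5`) [file `WeilClassesCyclicPrym`; modern form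
`…_degreeSix_iff_weilClassesOf` in `WeilClassesCyclicPrymTyping`], `…_degreeFour` (`g(C') = 5`, `ℚ(i)`-eightfold)
[file `WeilClassesCyclicPrymDegreeFour`]. The printed theorems carry NO restriction on the genus of the base curve
(beyond `g ≥ 2`), and for fixed `m ∈ {3, 4, 6}` the fixed-genus RENDERING is uniform in the genus — so the all-genera
statements below need no new carrier (the general-`m` form, `φ(m) > 2`, still waits for the `χ`-isotypic
decomposition of `H¹` named in those TODO lines). Each all-genera fact SPECIALISES DEFINITIONALLY to the tree's
fixed-genus fact (theorems `…_of_allGenera`, proved) — the faithfulness check of the rendering. Consumers: tribunal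
T3 «S-case in scope» checks for Weil-type rungs in EVERY dimension `2n` (LADDER-HodgeAV H2 cells; S4-PUSH at Weil
12-folds; eightfold seeds): the cyclic étale Prym loci are the refereed KNOWN sub-loci (hsemireg LIT2-WEIL §AU.2).

## Sources READ at this seat (2026-08-26), verbatim

Schoen 1988 (held Numdam scan `paper:url-4ceca4fec482`, scan file `pNNNN` = printed page `NNNN + 1`; OCR):
> (§2, p. 11 = p0010 L23–31) "Let `C` be an irreducible, smooth, projective curve over an algebraically closed
> field `k` of characteristic prime to a fixed integer `m > 1`. Suppose that an embedding `σ : ℤ/m → Aut(C)` is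
> given. Assume that the invariant `h` associated to `(C, σ)` in §1 is even. This implies that the number of
> branch points of the canonical quotient map `π : C → X` is an even number (1.5), which will be denoted `2r`.
> … **THEOREM 2.0**: If the `(ℤ/m)^*` orbit in `(ℤ/m - {0})^{2r}` associated to `(C, σ)` is simple, then the
> subspace `U ⊂ H^h(C_h, ℚ_ℓ(h/2))` is generated by fundamental classes of algebraic cycles."
> (p. 12 = p0011 L4–5) "Note that the simplicity hypothesis is automatically satisfied if `r = 0` or `1`."
> (§3, p. 24 = p0023 L9–41) "Let `m` be an integer greater than two … `K = ℚ(μ_m)` … `h = dim_K H¹(A, ℚ)` … a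
> Hodge substructure `U' ⊂ ⋀^h H¹(A, ℚ) ⊂ H^h(A, ℚ)` … the unique `K^*`-sub-representation of `⋀^h H¹(A, ℚ)` which
> after tensoring with `ℂ` becomes isomorphic to the sum of weight spaces `⊕ᵢ ψᵢ^h` … the abelian subvariety
> `B ⊂ Alb(C)` whose tangent space is the subspace of `T_e Alb(C)` … where `ℤ/m` acts by primitive characters. …
> **CORROLLARY 3.1**: If `(C, σ)` satisfies the hypotheses of (2.0), then `U' ⊂ H^h(B, ℚ)` is generated by
> fundamental classes of codimension `h/2` algebraic cycles."

Patel–Zhang (held arXiv text `paper:arxiv-2506.13729`, chunk `pNNNN`):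
> (p0003 L27) "Let `C → C'` be an étale `G`-cover of smooth projective curves, where the Galois group `G` is
> a finite abelian group. Let `h = 2g(C') - 2` and suppose `g(C') ≥ 2`." (p0003 L60–68) "`H¹(B, ℚ)` is a free
> `ℚ[G]_{nt}`-module with rank `h`, and the resulting top exterior power
> `U_Weil := ⋀^h_{ℚ[G]_{nt}} H¹(B, ℚ) ⊂ H^h(B, ℚ)` consists of Hodge classes … **Theorem 1.2.** The Hodge classes
> `U_Weil` are represented by algebraic cycles." (p0004 L1–2) "In the case of cyclic étale covers, Theorem 1.2
> is due to Chad Schoen [Schoen88]. … When `m = 3` (resp. `4`), these give rise to Weil abelian fourfolds with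
> CM field `ℚ(μ₃)` (resp. `ℚ(i)`) with trivial discriminant."
> (§5, p0012 L3–24) "We assume that `C → C'` is a cyclic unramified cover of smooth projective curves, with
> Galois group `G = ℤ/mℤ`. … **Lemma 5.1.** … `B` has dimension `(m-1)(g(C')-1)`. The generator `σ` above induces
> an automorphism of `B` of order `m`. … each eigenvalue `exp(2πki/m)` … occurs with multiplicity `g(C')-1`."
> (§5.1, p0012 L29–42) "**Definition 5.2.** … we call a character `χ` primitive if `χ : G → ℂ^*` is injective. …
> `B_prim := J(C)_{V_prim}` … `H¹(B_prim, ℚ)` is a vector space over `ℚ(μ_m)`, and the tangent space at origin …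
> decomposes as a direct sum of eigenspaces corresponding to the primitive characters, with each character
> appearing with multiplicity `h/2`. … `U_prim := ⋀^h_{ℚ(μ_m)} H¹(B_prim, ℚ) ⊆ H^h(B_prim, ℚ)` consists of Hodge
> classes … **Theorem 5.3 (Schoen88).** `U_prim` is generated by algebraic cycles."

## Rendering (IDENTICAL to the fixed-genus siblings; only the genus is a binder)

Write `g(C') = n + 1` with `n ≥ 1` (Patel–Zhang's `g(C') ≥ 2`; `h = 2n`). An étale cyclic cover of degree
`m` of `C'` by a connected curve `C` has `2g(C) - 2 = m · 2n` (Riemann–Hurwitz), i.e. `g(C) = m n + 1`, and the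
primitive Prym `B_prim` has dimension `h · φ(m)/2 = 2n` for `m ∈ {3, 4, 6}`. As in the siblings: `C` is a smooth
projective complex curve with a Jacobian `𝒥` (`Motives.Jacobian`) of dimension `m n + 1` and an automorphism
`α` with `α^m = 𝟙` generating a FREE `ℤ/m`-action (the powers `α^{m/p}`, `p | m` prime, have no fixed complex
point), `s := α_*` (`Jacobian.pushforward`), `B := (ker Φ_m(s))⁰` (`AbelianVariety.kerComponent`; `Φ₃(x) =
1 + x + x²`, `Φ₄(x) = 1 + x²` — written `𝟙 + e` with a separate binder `e = s ≫ s` exactly as in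
`…_degreeFour` —, `Φ₆(x) = 1 - x + x²`), which IS `B_prim` (`Φ_m` vanishes exactly at the primitive `m`-th
roots of unity among all `m`-th roots of unity); `s_B` is the restriction of `s` to `B`
(`kerComponentRestrict`), and the Weil operator `ψ₀` with `ψ₀² = -d` is `ψ₀ = 𝟙 + 2 s_B` (`m = 3`, `d = 3`),
`ψ₀ = s_B` (`m = 4`, `d = 1`), `ψ₀ = 𝟙 + 2 s_B²` (`m = 6`, `d = 3`) — the dictionary lemmas
`kerComponent_weilOperator_comp_self_of_cyclotomic₃`, `kerComponent_restrict_comp_self_eq_neg_id`,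
`kerComponent_weilOperator_comp_self'` of the sibling files are genus-free. TYPING (NOT in print, as in the
siblings, van Geemen LNM 1594, 4.9): the tree's Weil plane `weilClassesOf B ψ₀ n d = E₊ ⊔ E₋ ⊂ H^{2n}(B(ℂ); ℂ)` is
EXACTLY `U_prim ⊗ ℂ = ⋀^{2n} H¹_χ ⊕ ⋀^{2n} H¹_{χ̄}`, and "`U_prim` is generated by algebraic cycles" is "every class
of `weilClassesOf B ψ₀ n d` lies in `algebraicClasses B.X n`" (the `ℂ`-span of the codimension-`n` cycle classes).

## Placement of the `m = 4` locus (van Geemen 1996, §5 — appended 2026-08-26, same seat)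

B. van Geemen, Math. Z. 221 (1996) 617–631 [`vanGeemen1996ThetaFourfolds`, REFEREED; GDZ carrier PPN266833020_0221
LOG_0053, printed p. 629 READ BY EYE at this seat, p. 628 from the GDZ OCR + the lit-g13 by-eye sheet], verbatim:
> (5.1, p. 628) "Let `C_{n+1}` be a smooth curve of genus `n + 1`. A subgroup `G = ℤ/4ℤ ⊂ Pic⁰(C_{n+1})` defines a
> cyclic etale `4 : 1` covering of `C_{n+1}` and an intermediate etale `2 : 1` cover: `C_{4n+1} → C_{2n+1} → C_{n+1}`.
> The Prym variety `P` of the `C_{4n+1}/C_{2n+1}` is a principally polarized abelian variety of dimension `2n`. The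
> covering automorphism of `C_{4n+1}` over `C_{n+1}` induces an action of `ℤ[i]` on `P`."
> (5.2, p. 628) "Schoen constructs cycles on `P` by taking the inverse image of `ℙⁿ = |K| ⊂ C_{n+1}^{(2n)}` in
> `C_{4n+1}^{(2n)}` …, which is reducible, and mapping the components to `P`. He shows that suitable linear
> combinations of these cycles span the space of Weil-Hodge cycles `W ⊂ H^{2n}(P, ℚ)`." [= the `m = 4` all-genera
> fact below, restated in print]
> (**5.3 Theorem**, p. 629) "Let `P` be as in 5.1. Then: 1. The abelian variety `P` is of Weil type `(n,n)`, with
> field `ℚ(i)` and `det H = 1`. 2. There exist bases of `H₁(P, ℤ)` and `H₁(P, ℝ)` … such that the period matrix `Ω`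
> satisfies: `Ω = (I; τ) : H₁(P,ℤ) ≅ ℤ^{4n} → H₁(X,ℝ) = T₀P ≅ ℂ^{2n}` with `τ ∈ ℍ_{2n}`. In particular, `P` is
> isomorphic to an `X_τ` with `τ ∈ ℍ_{2n}`. 3. In case `n = 2`, the general abelian variety of Weil type `(2,2)` and
> field `ℚ(i)` with `det H = 1` is isogeneous to a Prym variety as in 5.1." (proof, p. 629: "`H₁(P, ℤ) =
> H₁(C_{4n+1}, ℤ)^{φ_*² = -1}` (the classes anti-invariant under `φ_*²`)" — so `P = (ker(1 + φ_*²))⁰`, the tree's `B`.)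

Typed below as `vanGeemen1996_cyclicQuarticPrym_weilType_hyperbolic_allGenera` ((i) `IsWeilType B s_B n 1`;
(ii) HYPERBOLIC = split Weil type for the `K`-symmetrised hyperplane class of SOME projective embedding — the tree's
reading of "`det H = 1`" through the DERIVED-ELEMENTARY step of record (HS/lit/LIT2-WEIL.md §T.1, HV/lit/SOURCES.md
§59): principal `ℤ[i]`-compatible polarization ⟹ `H` unimodular of signature `(n,n)` ⟹ normalised discriminant `1` in
van Geemen LNM 1594 (5.4.1) ⟹ hyperbolic (Landherr); at odd `n` the printed "`det H = 1`" can only denote this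
normalised class), followed by two proved consistency theorems: the every-member theorems already in the tree (van
Geemen 1996 Thm. 3.7 = `Schoen1988_…_three_or_one` at `d = 1`; Koike 2004 Cor. 2.1) APPLY to these Pryms.

## Faithfulness sheet (per declaration)

* `Schoen1988_cyclicPrym_weilClasses_algebraic_degreeThree_allGenera` — FAITHFUL (= Schoen Cor. 3.1 with
  Thm. 2.0 at `(q, m, r) = (n+1, 3, 0)`, all `n ≥ 1` = Patel–Zhang Thm. 5.3 at `G = ℤ/3`, all `g(C') ≥ 2`;
  WEAKER than print only in fixing `m`); REFEREED. Specialises to `…_degreeThree` (`n = 4`) and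
  `…_degreeThree_genusFour` (`n = 3`): theorems below.
* `Schoen1988_cyclicPrym_weilClasses_algebraic_degreeFour_allGenera` — FAITHFUL (same, `m = 4`); REFEREED.
  Specialises to `…_degreeFour` (`n = 4`). Its `n = 2` slice is the Prym FOURFOLD family of van Geemen, Math. Z.
  221 (1996) §5.1–5.3 [`vanGeemen1996ThetaFourfolds`, Thm. 5.3 (p. 629): "`P` is of Weil type `(n,n)`, with
  field `ℚ(i)` and `det H = 1` … In case `n = 2`, the general abelian variety of Weil type `(2,2)` and field
  `ℚ(i)` with `det H = 1` is isogeneous to a Prym variety as in 5.1"], its `n = 3` slice the Prym SIXFOLD family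
  of Koike 2004 [`Koike2004WeilHodge`, §2: "`P = Prym(C₁₃/C₇)` … the Weil classes `W(P)` are generated by
  algebraic cycles (see [Sc1])"] — placement statements NOT re-typed here.
* `Schoen1988_cyclicPrym_weilClasses_algebraic_degreeSix_allGenera` — FAITHFUL (same, `m = 6`, in the modern
  `weilClassesOf` form of `…_degreeSix_iff_weilClassesOf`); REFEREED. Specialises to `…_degreeSix` (`n = 4`).
* `vanGeemen1996_cyclicQuarticPrym_weilType_hyperbolic_allGenera` — conjunct (i) FAITHFUL (5.3 (1) "of Weil type
  `(n,n)`, with field `ℚ(i)`"); conjunct (ii) = 5.3 (1) "`det H = 1`" + 5.3 (2) read through the DERIVED-ELEMENTARY step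
  above (principal + `ℤ[i]`-compatible ⟹ normalised discriminant `1` ⟹ hyperbolic), WEAKER than print in asserting
  hyperbolicity for SOME projective embedding rather than naming the principal `Ξ`; REFEREED. 5.3 (3) NOT typed.
* `weilClassesOf_cyclicQuarticPrymFourfold_algebraic_of_vanGeemen1996`, `…Sixfold_algebraic_of_koike2004` — THEOREMS
  (consistency of the renderings; no new content).
* NOT-IN-PRINT content: none (the identification `weilClassesOf = U_prim ⊗ ℂ` is the siblings' typing
  convention, van Geemen 4.9). Nothing here asserts HC, HC_AV, or anything on a general member of a Weil
  component: for `n ≥ 4` these loci have positive codimension in the Weil moduli (Schoen 1988, p. 24: "In most,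
  but not all cases, such varieties form a subspace of positive codimension in the moduli of all Weil abelian
  varieties of fixed dimension").

## References

* [Schoen1988HodgeWeil] C. Schoen, Compositio Math. 65 (1988) 3–32: Thm. 2.0 (p. 11), p. 12, §3, Cor. 3.1 (p. 24).
* [PatelZhang2025PrymHodge] D. Patel, Y. Zhang, arXiv:2506.13729 = J. Algebra 712 (2027): Thm. 1.2, §1.3, §5, Thm. 5.3.
* [vanGeemen1996ThetaFourfolds] B. van Geemen, Math. Z. 221 (1996) 617–631: 1.3, 2.1 (pp. 618–619), Thm. 3.7
  (p. 624), §5.1–5.2 (p. 628), Thm. 5.3 (p. 629).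
* [Koike2004WeilHodge] K. Koike, Canad. Math. Bull. 47 (2004) 566–572: §2.
* [vanGeemen1994HodgeAV] B. van Geemen, LNM 1594 (1994): 4.9, 7.3–7.5.
-/

namespace Literature.AlgebraicGeometry.HodgeTheory

open CategoryTheory
open Literature.AlgebraicGeometry Literature.AlgebraicGeometry.Motives
open Literature.AlgebraicTopology.SingularHomology

/-! ### `m = 3`: `K = ℚ(μ₃) = ℚ(√-3)`, Prym `2n`-folds of étale cyclic triple covers of genus-`(n+1)` curves -/

/-- **Schoen's cyclic theorem, degree `3`, ALL genera (Schoen 1988, Thm. 2.0 + Cor. 3.1 at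
`(q, m, r) = (n + 1, 3, 0)`, every `n ≥ 1` = Patel–Zhang, Thm. 1.2 / Lemma 5.1 / Thm. 5.3 at `G = ℤ/3`, every
`g(C') ≥ 2`), on the tree's carriers.** PRINTED STATEMENT: for an étale cyclic cover `C → C'` of smooth
projective complex curves of degree `3` with `g(C') ≥ 2`, `h := 2g(C') - 2`, the Prym
`B = (ker Nm)⁰ = (ker(1 + σ + σ²))⁰ ⊂ J(C)` (dimension `2(g(C') - 1)`, Lemma 5.1; `m = 3` prime, so `B = B_prim`)
has `H¹(B, ℚ)` a `ℚ(μ₃)`-vector space of dimension `h`, and `U_prim := ⋀^h_{ℚ(μ₃)} H¹(B, ℚ) ⊂ H^h(B, ℚ)` "is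
generated by algebraic cycles" (Patel–Zhang Thm. 5.3 "(Schoen88)"; Schoen Cor. 3.1: "If `(C, σ)` satisfies the
hypotheses of (2.0), then `U' ⊂ H^h(B, ℚ)` is generated by fundamental classes of codimension `h/2` algebraic
cycles", the simplicity hypothesis of Thm. 2.0 being "automatically satisfied if `r = 0`", p. 12). No
genericity hypothesis on the cover, no restriction on the genus. RENDERING (module docstring; the binder shape
of `Schoen1988_cyclicPrym_weilClasses_algebraic_degreeThree` with `13 ↦ 3n + 1`, `4 ↦ n`): `g(C') = n + 1`,
`g(C) = 3n + 1` (Riemann–Hurwitz), `α³ = 𝟙` acting freely, `s = α_*`, `P = (ker(𝟙 + s + s²))⁰` the Prym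
`2n`-fold, `s_P` the restriction of `s`, `ψ₀ = 𝟙 + 2 s_P` (`ψ₀² = -3`,
`kerComponent_weilOperator_comp_self_of_cyclotomic₃`); conclusion: every class of the Weil plane
`weilClassesOf P ψ₀ n 3 = ⋀^{2n} H¹_{ζ₃} ⊕ ⋀^{2n} H¹_{ζ₃²} = U_prim ⊗ ℂ` lies in `algebraicClasses P.X n`.
Grade: REFEREED (both sources). Faithfulness: FAITHFUL (the `m = 3` slice of the printed all-`(m, q)` theorem);
specialises definitionally to the tree's `…_degreeThree` (`n = 4`) and `…_degreeThree_genusFour` (`n = 3`).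
[cite: Schoen1988HodgeWeil, Thm 2.0 (p. 11), p. 12 lines 4–5, and Cor 3.1 (p. 24), at (q, m, r) = (n+1, 3, 0)]
[cite: PatelZhang2025PrymHodge, Thm 1.2, Lemma 5.1, §5.1 and Thm 5.3] -/
def Schoen1988_cyclicPrym_weilClasses_algebraic_degreeThree_allGenera : Prop :=
  ∀ (n : ℕ), 1 ≤ n → ∀ (C : SchemeOver ℂ) (𝒥 : Jacobian C) (α : C ⟶ C),
    IsSmoothProjective 1 C → 𝒥.J.dim = 3 * n + 1 →
    α ≫ α ≫ α = 𝟙 C →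
    (∀ P : ComplexPoints C, P ≫ α ≠ P) →
  ∀ (s : 𝒥.J ⟶ 𝒥.J), s = 𝒥.pushforward 𝒥 α →
  ∀ (sP ψ₀ : AbelianVariety.kerComponent (𝟙 𝒥.J + s + s ≫ s) ⟶
      AbelianVariety.kerComponent (𝟙 𝒥.J + s + s ≫ s)),
    sP ≫ AbelianVariety.kerComponentι (𝟙 𝒥.J + s + s ≫ s) =
      AbelianVariety.kerComponentι (𝟙 𝒥.J + s + s ≫ s) ≫ s →
    ψ₀ = 𝟙 _ + 2 • sP →
  ∀ c ∈ weilClassesOf (AbelianVariety.kerComponent (𝟙 𝒥.J + s + s ≫ s)) ψ₀ n 3,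
    c ∈ algebraicClasses (AbelianVariety.kerComponent (𝟙 𝒥.J + s + s ≫ s)).X n

/-- The all-genera fact at `n = 4` (`g(C') = 5`, `g(C) = 13`, Prym eightfold) IS the tree's
`Schoen1988_cyclicPrym_weilClasses_algebraic_degreeThree` — the rendering is the siblings' one, verbatim.
[cite: Schoen1988HodgeWeil, Cor 3.1 (p. 24), at (q, m, r) = (5, 3, 0)] -/
theorem Schoen1988_cyclicPrym_weilClasses_algebraic_degreeThree_of_allGenera
    (h : Schoen1988_cyclicPrym_weilClasses_algebraic_degreeThree_allGenera) :
    Schoen1988_cyclicPrym_weilClasses_algebraic_degreeThree :=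
  fun C 𝒥 α hC hdim hα hfree s hs sP ψ₀ hsP hψ₀ c hc =>
    h 4 (by norm_num) C 𝒥 α hC (hdim.trans (by norm_num)) hα hfree s hs sP ψ₀ hsP hψ₀ c hc

/-- The all-genera fact at `n = 3` (`g(C') = 4`, `g(C) = 10`, Prym sixfold: the general member of the SPLIT
sixfold component `K = ℚ(√-3)`, van Geemen LNM 1594, 7.3) IS the tree's
`Schoen1988_cyclicPrym_weilClasses_algebraic_degreeThree_genusFour`.
[cite: Schoen1988HodgeWeil, Cor 3.1 (p. 24), at (q, m, r) = (4, 3, 0)] [cite: vanGeemen1994HodgeAV, 7.3 (p. 234)] -/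
theorem Schoen1988_cyclicPrym_weilClasses_algebraic_degreeThree_genusFour_of_allGenera
    (h : Schoen1988_cyclicPrym_weilClasses_algebraic_degreeThree_allGenera) :
    Schoen1988_cyclicPrym_weilClasses_algebraic_degreeThree_genusFour :=
  fun C 𝒥 α hC hdim hα hfree s hs sP ψ₀ hsP hψ₀ c hc =>
    h 3 (by norm_num) C 𝒥 α hC (hdim.trans (by norm_num)) hα hfree s hs sP ψ₀ hsP hψ₀ c hc

/-! ### `m = 4`: `K = ℚ(μ₄) = ℚ(i)`, primitive Prym `2n`-folds of étale cyclic quartic covers of genus-`(n+1)` curves -/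

/-- **Schoen's cyclic theorem, degree `4`, ALL genera: the primitive Prym `2n`-fold of `ℚ(i)`-Weil type
(Schoen 1988, Thm. 2.0 + Cor. 3.1 at `(q, m, r) = (n + 1, 4, 0)`, every `n ≥ 1` = Patel–Zhang, Thm. 1.2 /
Thm. 5.3 with §5.1 at `G = ℤ/4`, every `g(C') ≥ 2`), on the tree's carriers.** PRINTED STATEMENT: Schoen 1988,
Cor. 3.1 (p. 24): "If `(C, σ)` satisfies the hypotheses of (2.0), then `U' ⊂ H^h(B, ℚ)` is generated by
fundamental classes of codimension `h/2` algebraic cycles" — `B ⊂ J(C)` the abelian subvariety on which `σ`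
acts through the PRIMITIVE fourth roots of unity, `U' = ⋀^h_{ℚ(i)} H¹(B, ℚ)`, `h = 2g(C') - 2` for an
unramified (`r = 0`) cyclic cover `C → C' = C/⟨σ⟩` of degree `4`, the hypothesis of Thm. 2.0 (p. 11) being
"automatically satisfied if `r = 0`" (p. 12); Patel–Zhang Thm. 5.3 "(Schoen88). `U_prim` is generated by
algebraic cycles", `U_prim := ⋀^h_{ℚ(μ₄)} H¹(B_prim, ℚ)`, `B_prim = J(C)_{V_prim}` (§5.1, each primitive
character of multiplicity `h/2` on `T₀B_prim`), and p. 4: "When `m = 3` (resp. `4`), these give rise to Weil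
abelian [varieties] with CM field `ℚ(μ₃)` (resp. `ℚ(i)`) with trivial discriminant". No genericity hypothesis
on the cover, no restriction on the genus. RENDERING (module docstring; the binder shape of
`Schoen1988_cyclicPrym_weilClasses_algebraic_degreeFour` with `17 ↦ 4n + 1`, `4 ↦ n`): `g(C') = n + 1`,
`g(C) = 4n + 1`, `α⁴ = 𝟙` with `α²` fixed-point free (so `⟨α⟩ ≅ ℤ/4` acts freely), `s = α_*`, a separate binder
`e = s ≫ s`, `B = (ker(𝟙 + e))⁰ = (ker Φ₄(s))⁰ = B_prim` (`H¹(B; ℂ) = H¹_{i} ⊕ H¹_{-i}`, `2n + 2n`), `s_B` the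
restriction of `s` to `B`, Weil operator `ψ₀ = s_B` (`s_B² = -𝟙`, `kerComponent_restrict_comp_self_eq_neg_id`);
conclusion: every class of `weilClassesOf B s_B n 1 = ⋀^{2n} H¹_{i} ⊕ ⋀^{2n} H¹_{-i} = U_prim ⊗ ℂ` lies in
`algebraicClasses B.X n`. In print for all `n` also as van Geemen 1996, 5.2 (p. 628): "Schoen constructs
cycles on `P` … He shows that suitable linear combinations of these cycles span the space of Weil-Hodge cycles
`W ⊂ H^{2n}(P, ℚ)`". Slices in print: `n = 2` — van Geemen 1996 §5.1–5.3 (these Prym fourfolds are the `X_τ`,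
`τ ∈ ℍ₄`, and the general `(2,2)`, `ℚ(i)`, `det H = 1` fourfold is isogenous to one, Thm. 5.3 (3));
`n = 3` — Koike 2004 §2 (`P = Prym(C₁₃/C₇)`, whose Prym map is dominant onto the split `ℚ(i)` sixfold
component, Thm. 2.1); `n = 4` — the tree's `…_degreeFour` (van Geemen–Verra 2003, Cor. 4.10's input).
Grade: REFEREED (both sources). Faithfulness: FAITHFUL (the `m = 4` slice of the printed all-`(m, q)` theorem);
specialises definitionally to the tree's `…_degreeFour` (`n = 4`).
[cite: Schoen1988HodgeWeil, Thm 2.0 (p. 11), p. 12 lines 4–5, and Cor 3.1 (p. 24), at (q, m, r) = (n+1, 4, 0)]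
[cite: PatelZhang2025PrymHodge, Thm 1.2, §1.3 (p. 4), §5.1 and Thm 5.3]
[cite: vanGeemen1996ThetaFourfolds, §5.1, 5.2 and Thm. 5.3 (pp. 628–629)] [cite: Koike2004WeilHodge, §2] -/
def Schoen1988_cyclicPrym_weilClasses_algebraic_degreeFour_allGenera : Prop :=
  ∀ (n : ℕ), 1 ≤ n → ∀ (C : SchemeOver ℂ) (𝒥 : Jacobian C) (α : C ⟶ C),
    IsSmoothProjective 1 C → 𝒥.J.dim = 4 * n + 1 →
    α ≫ α ≫ α ≫ α = 𝟙 C →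
    (∀ P : ComplexPoints C, P ≫ (α ≫ α) ≠ P) →
  ∀ (s e : 𝒥.J ⟶ 𝒥.J), s = 𝒥.pushforward 𝒥 α → e = s ≫ s →
  ∀ (sB : AbelianVariety.kerComponent (𝟙 𝒥.J + e) ⟶ AbelianVariety.kerComponent (𝟙 𝒥.J + e)),
    sB ≫ AbelianVariety.kerComponentι (𝟙 𝒥.J + e) = AbelianVariety.kerComponentι (𝟙 𝒥.J + e) ≫ s →
  ∀ c ∈ weilClassesOf (AbelianVariety.kerComponent (𝟙 𝒥.J + e)) sB n 1,
    c ∈ algebraicClasses (AbelianVariety.kerComponent (𝟙 𝒥.J + e)).X n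

/-- The all-genera fact at `n = 4` (`g(C') = 5`, `g(C) = 17`, the `ℚ(i)`-Weil primitive Prym eightfold) IS
the tree's `Schoen1988_cyclicPrym_weilClasses_algebraic_degreeFour`.
[cite: Schoen1988HodgeWeil, Cor 3.1 (p. 24), at (q, m, r) = (5, 4, 0)] -/
theorem Schoen1988_cyclicPrym_weilClasses_algebraic_degreeFour_of_allGenera
    (h : Schoen1988_cyclicPrym_weilClasses_algebraic_degreeFour_allGenera) :
    Schoen1988_cyclicPrym_weilClasses_algebraic_degreeFour :=
  fun C 𝒥 α hC hdim hα hfree s e hs he sB hsB c hc =>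
    h 4 (by norm_num) C 𝒥 α hC (hdim.trans (by norm_num)) hα hfree s e hs he sB hsB c hc

/-! ### `m = 6`: `K = ℚ(μ₆) = ℚ(√-3)`, primitive Prym `2n`-folds of étale cyclic sextic covers of genus-`(n+1)` curves -/

/-- **Schoen's cyclic theorem, degree `6`, ALL genera: the primitive Prym `2n`-fold of `ℚ(√-3)`-Weil type
(Schoen 1988, Thm. 2.0 + Cor. 3.1 at `(q, m, r) = (n + 1, 6, 0)`, every `n ≥ 1` = Patel–Zhang, Thm. 1.2 /
Thm. 5.3 with Lemma 5.1 and §5.1 at `G = ℤ/6`, every `g(C'') ≥ 2`), on the tree's carriers, in the Weil-class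
vocabulary of `Schoen1988_cyclicPrym_weilClasses_algebraic_degreeSix_iff_weilClassesOf`.** PRINTED STATEMENT
(as for `m = 3, 4`): for an étale cyclic cover `C → C''` of degree `6` of smooth projective complex curves with
`g(C'') ≥ 2`, `h := 2g(C'') - 2`, Schoen's primitive Prym `B_prim = J(C)_{V_prim} ⊂ J(C)` (the abelian
subvariety on which `ℤ/6` acts through the primitive sixth roots of unity; `m = 6` not prime, so `B_prim` is
a proper factor of `(ker Nm)⁰`, Patel–Zhang §5) has `H¹(B_prim, ℚ)` a `ℚ(μ₆)`-vector space with each primitive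
character of multiplicity `h/2` on `T₀B_prim` (§5.1), and `U_prim := ⋀^h_{ℚ(μ₆)} H¹(B_prim, ℚ)` "is generated
by algebraic cycles" (Thm. 5.3 "(Schoen88)" = Schoen Cor. 3.1 with Thm. 2.0, `r = 0`). No genericity
hypothesis, no restriction on the genus. RENDERING (module docstring; the binder shape of
`Schoen1988_cyclicPrym_weilClasses_algebraic_degreeSix` with `25 ↦ 6n + 1`, `4 ↦ n`): `g(C'') = n + 1`,
`g(C) = 6n + 1`, `α⁶ = 𝟙` with `α²`, `α³` fixed-point free, `s = α_*`, `B = (ker(𝟙 - s + s²))⁰ = (ker Φ₆(s))⁰ =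
B_prim` (an abelian `2n`-fold, `H¹(B; ℂ) = H¹_{ζ₆} ⊕ H¹_{ζ₆⁻¹}`), `s_B` the restriction of `s`,
`ψ₀ = 𝟙 + 2 s_B²` (`ψ₀² = -3`, `kerComponent_weilOperator_comp_self'`); conclusion: every class of
`weilClassesOf B ψ₀ n 3 = ⋀^{2n} H¹_{ζ₆} ⊕ ⋀^{2n} H¹_{ζ₆⁻¹} = U_prim ⊗ ℂ` lies in `algebraicClasses B.X n`.
Grade: REFEREED (both sources). Faithfulness: FAITHFUL (the `m = 6` slice of the printed all-`(m, q)`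
theorem); at `n = 4` it is the right-hand side of the tree's `…_degreeSix_iff_weilClassesOf`, hence gives
`…_degreeSix` (theorem below).
[cite: Schoen1988HodgeWeil, Thm 2.0 (p. 11), p. 12 lines 4–5, and Cor 3.1 (p. 24), at (q, m, r) = (n+1, 6, 0)]
[cite: PatelZhang2025PrymHodge, Thm 1.2, Lemma 5.1, §5.1 and Thm 5.3] -/
def Schoen1988_cyclicPrym_weilClasses_algebraic_degreeSix_allGenera : Prop :=
  ∀ (n : ℕ), 1 ≤ n → ∀ (C : SchemeOver ℂ) (𝒥 : Jacobian C) (α : C ⟶ C),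
    IsSmoothProjective 1 C → 𝒥.J.dim = 6 * n + 1 →
    α ≫ α ≫ α ≫ α ≫ α ≫ α = 𝟙 C →
    (∀ P : ComplexPoints C, P ≫ (α ≫ α) ≠ P ∧ P ≫ (α ≫ α ≫ α) ≠ P) →
  ∀ (s : 𝒥.J ⟶ 𝒥.J), s = 𝒥.pushforward 𝒥 α →
  ∀ (sB ψ₀ : AbelianVariety.kerComponent (𝟙 𝒥.J - s + s ≫ s) ⟶
      AbelianVariety.kerComponent (𝟙 𝒥.J - s + s ≫ s)),
    sB ≫ AbelianVariety.kerComponentι (𝟙 𝒥.J - s + s ≫ s) =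
      AbelianVariety.kerComponentι (𝟙 𝒥.J - s + s ≫ s) ≫ s →
    ψ₀ = 𝟙 _ + 2 • (sB ≫ sB) →
  ∀ c ∈ weilClassesOf (AbelianVariety.kerComponent (𝟙 𝒥.J - s + s ≫ s)) ψ₀ n 3,
    c ∈ algebraicClasses (AbelianVariety.kerComponent (𝟙 𝒥.J - s + s ≫ s)).X n

/-- The all-genera fact at `n = 4` (`g(C'') = 5`, `g(C) = 25`, primitive Prym eightfold) gives the tree's
`Schoen1988_cyclicPrym_weilClasses_algebraic_degreeSix` through the tree's equivalence
`…_degreeSix_iff_weilClassesOf` (eigenspaces of `(2·𝟙 + ψ₀)^*` on `H⁸` = the Weil plane).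
[cite: Schoen1988HodgeWeil, Cor 3.1 (p. 24), at (q, m, r) = (5, 6, 0)] [cite: vanGeemen1994HodgeAV, 4.9] -/
theorem Schoen1988_cyclicPrym_weilClasses_algebraic_degreeSix_of_allGenera
    (h : Schoen1988_cyclicPrym_weilClasses_algebraic_degreeSix_allGenera) :
    Schoen1988_cyclicPrym_weilClasses_algebraic_degreeSix :=
  Schoen1988_cyclicPrym_weilClasses_algebraic_degreeSix_iff_weilClassesOf.mpr
    fun C 𝒥 α hC hdim hα hfree s hs sB ψ₀ hsB hψ₀ c hc =>
      h 4 (by norm_num) C 𝒥 α hC (hdim.trans (by norm_num)) hα hfree s hs sB ψ₀ hsB hψ₀ c hc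

/-! ### Placement of the `m = 4` locus: van Geemen 1996, Thm. 5.3 — the `ℤ/4` étale Pryms are SPLIT `ℚ(i)`-Weil `2n`-folds -/

/-- **van Geemen 1996, Thm. 5.3 (1)–(2) (Math. Z. 221, p. 629), with 5.1 (p. 628) and 2.1 (pp. 618–619): the Prym
`P = Prym(C_{4n+1}/C_{2n+1})` of the intermediate double cover of a cyclic ÉTALE `4 : 1` cover `C_{4n+1} → C_{n+1}`
of a genus-`(n+1)` curve — "a principally polarized abelian variety of dimension `2n`" on which "the covering
automorphism … induces an action of `ℤ[i]`" — "is of Weil type `(n,n)`, with field `ℚ(i)` and `det H = 1`", and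
"is isomorphic to an `X_τ` with `τ ∈ ℍ_{2n}`" (the family of 2.1: `φ_* = M`, `M² = -1`, "`φ^*` preserves the
polarization: `E(φ_*x, φ_*y) = E(x, y)`", "`H(x, y) := E(x, φ_*y) + iE(x, y)` … its determinant (modulo norms …)
is an isogeny invariant … `det H = 1`").** EVERY `n ≥ 1`, no genericity hypothesis. RENDERING (module docstring;
the datum is VERBATIM that of `Schoen1988_cyclicPrym_weilClasses_algebraic_degreeFour_allGenera`: `g(C) = 4n + 1`,
`α⁴ = 𝟙` with `α²` fixed-point free, `s = α_*`, `e = s ≫ s`, `B = (ker(𝟙 + e))⁰ = P` — proof of 5.3: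
"`H₁(P, ℤ) = H₁(C_{4n+1}, ℤ)^{φ_*² = -1}`" —, `s_B` the restriction of `s`): (i) `(B, s_B)` is of Weil type `(n, n)`
for `K = ℚ(s_B) = ℚ(i)`, `d = 1` (`IsWeilType B s_B n 1`: `dim B = 2n`, `s_B² = -1`, the eigenvalue `i` of `s_B^*`
on `H^{1,0}(B)` has multiplicity `n` — also Patel–Zhang §5.1: "each [primitive] character appearing with
multiplicity `h/2`" on `T₀B_prim`); (ii) "`det H = 1`" in the tree's vocabulary: `(B, s_B)` is of HYPERBOLIC
(= split) Weil type, `Motives.IsHyperbolicWeilType B s_B n h`, for the `K`-symmetrised hyperplane class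
`h = 1·e'^*a + s_B^* e'^*a` of SOME projective embedding `e'` of `B` and some non-zero rational `a ∈ H²(ℙᴺ(ℂ); ℂ)`
— DERIVED-ELEMENTARY reading (module docstring; HS/lit/LIT2-WEIL.md §T.1, HV/lit/SOURCES.md §59): the PRINCIPAL,
`ℤ[i]`-compatible polarization of 5.1/2.1 makes `H` a unimodular `ℤ[i]`-hermitian form of signature `(n,n)`, so
the normalised discriminant of van Geemen LNM 1594 (5.4.1) is `1`, which is hyperbolicity (Landherr), for the
embedding by `3Ξ` (`K`-symmetrised class `6Ξ`; scaling by `ℚ_{>0}` does not change the class). Part (3) of 5.3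
(`n = 2`: "the general abelian variety of Weil type `(2,2)` and field `ℚ(i)` with `det H = 1` is isogeneous to a
Prym variety as in 5.1") is NOT typed here. Grade: REFEREED; (ii) WEAKER than print (some embedding, not `Ξ` by
name). Koike 2004, §2 (p0004 L55–57) prints the `n = 3` slice: "`P = Prym(C₁₃/C₇)` … is a principally polarized
6-dimensional Abelian variety … of Weil type for `ℚ(√-1)` … the discriminant `δ` of `P` is `1` (see [vG2])".
Users take `(h : vanGeemen1996_cyclicQuarticPrym_weilType_hyperbolic_allGenera)`.
[cite: vanGeemen1996ThetaFourfolds, Thm. 5.3 (1)–(2) (p. 629), 5.1–5.2 (p. 628), 2.1 (pp. 618–619)]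
[cite: PatelZhang2025PrymHodge, Lemma 5.1 and §5.1] [cite: Koike2004WeilHodge, §2]
[cite: vanGeemen1994HodgeAV, Lemma 5.2 (3), 5.4 (5.4.1)] -/
def vanGeemen1996_cyclicQuarticPrym_weilType_hyperbolic_allGenera : Prop :=
  ∀ (n : ℕ), 1 ≤ n → ∀ (C : SchemeOver ℂ) (𝒥 : Jacobian C) (α : C ⟶ C),
    IsSmoothProjective 1 C → 𝒥.J.dim = 4 * n + 1 →
    α ≫ α ≫ α ≫ α = 𝟙 C →
    (∀ P : ComplexPoints C, P ≫ (α ≫ α) ≠ P) →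
  ∀ (s e : 𝒥.J ⟶ 𝒥.J), s = 𝒥.pushforward 𝒥 α → e = s ≫ s →
  ∀ (sB : AbelianVariety.kerComponent (𝟙 𝒥.J + e) ⟶ AbelianVariety.kerComponent (𝟙 𝒥.J + e)),
    sB ≫ AbelianVariety.kerComponentι (𝟙 𝒥.J + e) = AbelianVariety.kerComponentι (𝟙 𝒥.J + e) ≫ s →
  IsWeilType (AbelianVariety.kerComponent (𝟙 𝒥.J + e)) sB n 1 ∧
    ∃ (e' : Motives.ProjectiveEmbedding (AbelianVariety.kerComponent (𝟙 𝒥.J + e)).X)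
      (a : complexBetti (Motives.projectiveSpace e'.n ℂ) 2), IsRationalClass a ∧ a ≠ 0 ∧
      Motives.IsHyperbolicWeilType (AbelianVariety.kerComponent (𝟙 𝒥.J + e)) sB n
        (((1 : ℕ) : ℂ) • complexBetti.map e'.ι 2 a +
          complexBetti.map sB.hom.hom.hom 2 (complexBetti.map e'.ι 2 a))

/-- **Consistency, `n = 2`: van Geemen's every-member FOURFOLD theorem applies to his own Pryms.** With the
placement fact, the tree's `Schoen1988_weilClasses_algebraic_hyperbolicFourfold_three_or_one` (van Geemen 1996
Thm. 3.7 at `K = ℚ(i)`: every HYPERBOLIC `ℚ(i)`-Weil fourfold) gives: every RATIONAL `(2,2)`-class of the Weil plane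
of the `ℤ/4` étale Prym fourfold (`g(C') = 3`, `g(C) = 9`) is algebraic — the rational-Hodge-class part of the `n = 2`
slice of `Schoen1988_cyclicPrym_weilClasses_algebraic_degreeFour_allGenera`, reached through the component theorem
instead of Schoen's cycles (van Geemen 1996, 1.3: "the abelian varieties we consider are among those studied by
Schoen [S], however, our method is different").
[cite: vanGeemen1996ThetaFourfolds, Thm. 3.7 (p. 624), 1.3 (p. 618) and Thm. 5.3 (p. 629)] -/
theorem weilClassesOf_cyclicQuarticPrymFourfold_algebraic_of_vanGeemen1996
    (hP : vanGeemen1996_cyclicQuarticPrym_weilType_hyperbolic_allGenera)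
    (hS : Schoen1988_weilClasses_algebraic_hyperbolicFourfold_three_or_one)
    (C : SchemeOver ℂ) (𝒥 : Jacobian C) (α : C ⟶ C) (hC : IsSmoothProjective 1 C) (hdim : 𝒥.J.dim = 9)
    (hα : α ≫ α ≫ α ≫ α = 𝟙 C) (hfree : ∀ P : ComplexPoints C, P ≫ (α ≫ α) ≠ P)
    (s e : 𝒥.J ⟶ 𝒥.J) (hs : s = 𝒥.pushforward 𝒥 α) (he : e = s ≫ s)
    (sB : AbelianVariety.kerComponent (𝟙 𝒥.J + e) ⟶ AbelianVariety.kerComponent (𝟙 𝒥.J + e))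
    (hsB : sB ≫ AbelianVariety.kerComponentι (𝟙 𝒥.J + e) = AbelianVariety.kerComponentι (𝟙 𝒥.J + e) ≫ s)
    (c : complexBetti (AbelianVariety.kerComponent (𝟙 𝒥.J + e)).X (2 * 2)) (hc : IsRationalClass c)
    (h22 : IsOfHodgeType (2 * 2) (AbelianVariety.kerComponent (𝟙 𝒥.J + e)).X (2 * 2) 2 2 c)
    (hW : c ∈ weilClassesOf (AbelianVariety.kerComponent (𝟙 𝒥.J + e)) sB 2 1) :
    c ∈ algebraicClasses (AbelianVariety.kerComponent (𝟙 𝒥.J + e)).X 2 := by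
  obtain ⟨hWT, e', a, ha, ha0, hhyp⟩ :=
    hP 2 (by norm_num) C 𝒥 α hC (hdim.trans (by norm_num)) hα hfree s e hs he sB hsB
  exact hS 1 (Or.inl rfl) _ sB hWT.dim_eq hWT.isSmoothProjective hWT.sq_eq e' a ha ha0 hhyp c hc h22 hW

/-- **Consistency, `n = 3`: Koike's every-member SIXFOLD theorem applies to Koike's own Prym `P = Prym(C₁₃/C₇)`.**
With the placement fact, the tree's `Koike2004_weilClasses_algebraic_hyperbolicSixfold_one` (Koike 2004 Cor. 2.1:
every HYPERBOLIC `ℚ(i)`-Weil sixfold) gives: every RATIONAL `(3,3)`-class of the Weil plane of the `ℤ/4` étale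
Prym sixfold (`g(C') = 4`, `g(C) = 13`) is algebraic — the rational-Hodge-class part of the `n = 3` slice of
`Schoen1988_cyclicPrym_weilClasses_algebraic_degreeFour_allGenera` (Koike §2: "the Weil classes `W(P)` are
generated by algebraic cycles (see [Sc1])").
[cite: Koike2004WeilHodge, §2 and Cor. 2.1] [cite: vanGeemen1996ThetaFourfolds, Thm. 5.3 (p. 629)] -/
theorem weilClassesOf_cyclicQuarticPrymSixfold_algebraic_of_koike2004
    (hP : vanGeemen1996_cyclicQuarticPrym_weilType_hyperbolic_allGenera)
    (hK : Koike2004_weilClasses_algebraic_hyperbolicSixfold_one)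
    (C : SchemeOver ℂ) (𝒥 : Jacobian C) (α : C ⟶ C) (hC : IsSmoothProjective 1 C) (hdim : 𝒥.J.dim = 13)
    (hα : α ≫ α ≫ α ≫ α = 𝟙 C) (hfree : ∀ P : ComplexPoints C, P ≫ (α ≫ α) ≠ P)
    (s e : 𝒥.J ⟶ 𝒥.J) (hs : s = 𝒥.pushforward 𝒥 α) (he : e = s ≫ s)
    (sB : AbelianVariety.kerComponent (𝟙 𝒥.J + e) ⟶ AbelianVariety.kerComponent (𝟙 𝒥.J + e))
    (hsB : sB ≫ AbelianVariety.kerComponentι (𝟙 𝒥.J + e) = AbelianVariety.kerComponentι (𝟙 𝒥.J + e) ≫ s)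
    (c : complexBetti (AbelianVariety.kerComponent (𝟙 𝒥.J + e)).X (2 * 3)) (hc : IsRationalClass c)
    (h33 : IsOfHodgeType (2 * 3) (AbelianVariety.kerComponent (𝟙 𝒥.J + e)).X (2 * 3) 3 3 c)
    (hW : c ∈ weilClassesOf (AbelianVariety.kerComponent (𝟙 𝒥.J + e)) sB 3 1) :
    c ∈ algebraicClasses (AbelianVariety.kerComponent (𝟙 𝒥.J + e)).X 3 := by
  obtain ⟨hWT, e', a, ha, ha0, hhyp⟩ :=
    hP 3 (by norm_num) C 𝒥 α hC (hdim.trans (by norm_num)) hα hfree s e hs he sB hsB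
  exact hK _ sB hWT.dim_eq hWT.isSmoothProjective hWT.sq_eq e' a ha ha0 hhyp c hc h33 hW

end Literature.AlgebraicGeometry.HodgeTheory
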